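import Summits.AtomisticToContinuum.BoseEinsteinCondensation.Theses.BECCellInformation
import Summits.AtomisticToContinuum.BoseEinsteinCondensation.Theorems.BECCellInformationCoarseChainRule

/-!
# Crux-strategist sketch for `CellInformationBound` (stmt-AtomisticToContinuum-13439)

Typed signatures backing `STRATEGY-CENSUS.md` (strategist seat `cstrat-stmt-AtomisticToContinuum-13439-s1`,
2026-08-17).  Nothing here is registered as a line; every `def … : Prop` is a census object
(Strengthen / Decomposition / Negation), and the only theorems are sorry-free pieces of glue that
certify which piece of each split carries the crux.

Notation (as in the route file): for `Ψ ∈ TrialState (n+1) L`, `L = sideLength ρ (n+1)`,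
`M = ⌈L/l⌉₊`, cells `k : Fin 3 → Fin M` of side `L/M`; `A_k(Y) = ∫_(cell k) |Ψ(x,Y)|² dx`,
`m(Y) = ∫ |Ψ(z,Y)|² dz`, `P_k = ∫ A_k(Y') dY'`; `cellMI ρ l n Ψ = ∫⁻ dY ofReal(Σ_k m P_k klFun(A_k/(m P_k)))`
is VERBATIM the left-hand side of the crux (`= I(cell_l(x₁) ; Y)`).
-/

namespace Summit.AtomisticToContinuum.BoseEinsteinCondensation.Cruxes.CellInformationBound.Strategist

open scoped BigOperators Topology Classical MeasureTheory ENNReal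
open Filter Set MeasureTheory
open Literature.MathematicalPhysics.QuantumManyBody.BoseGas
open Summit.AtomisticToContinuum.BoseEinsteinCondensation.Theses.BECCellInformation

/-- The bath marginal density `m(Y) = ∫ |Ψ(z :: Y)|² dz`. -/
noncomputable def mass {n : ℕ} {L : ℝ} (Ψ : TrialState (n + 1) L) (Y : Config n) : ℝ :=
  ∫ z, ‖Ψ.ψ (Matrix.vecCons z Y)‖ ^ 2

/-- The pointwise-in-`Y` mutual-information integrand `Σ_k m(Y) P_k klFun(A_k(Y)/(m(Y)P_k))`
(`= m(Y) · KL(Q(·|Y) ‖ P)`), verbatim the crux's summand. -/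
noncomputable def cellKL (ρ l : ℝ) (n : ℕ) (Ψ : TrialState (n + 1) (sideLength ρ (n + 1)))
    (Y : Config n) : ℝ :=
  ∑ k : Fin 3 → Fin ⌈sideLength ρ (n + 1) / l⌉₊, (∫ z, ‖Ψ.ψ (Matrix.vecCons z Y)‖ ^ 2) * (∫ Y' : Config n, ∫ x in {y : EuclideanSpace ℝ (Fin 3) | ∀ j, y j ∈ Set.Ico (((k j : ℕ) : ℝ) * (sideLength ρ (n + 1) / (⌈sideLength ρ (n + 1) / l⌉₊ : ℝ))) ((((k j : ℕ) : ℝ) + 1) * (sideLength ρ (n + 1) / (⌈sideLength ρ (n + 1) / l⌉₊ : ℝ)))}, ‖Ψ.ψ (Matrix.vecCons x Y')‖ ^ 2) * InformationTheory.klFun ((∫ x in {y : EuclideanSpace ℝ (Fin 3) | ∀ j, y j ∈ Set.Ico (((k j : ℕ) : ℝ) * (sideLength ρ (n + 1) / (⌈sideLength ρ (n + 1) / l⌉₊ : ℝ))) ((((k j : ℕ) : ℝ) + 1) * (sideLength ρ (n + 1) / (⌈sideLength ρ (n + 1) / l⌉₊ : ℝ)))}, ‖Ψ.ψ (Matrix.vecCons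 x Y)‖ ^ 2) / ((∫ z, ‖Ψ.ψ (Matrix.vecCons z Y)‖ ^ 2) * (∫ Y' : Config n, ∫ x in {y : EuclideanSpace ℝ (Fin 3) | ∀ j, y j ∈ Set.Ico (((k j : ℕ) : ℝ) * (sideLength ρ (n + 1) / (⌈sideLength ρ (n + 1) / l⌉₊ : ℝ))) ((((k j : ℕ) : ℝ) + 1) * (sideLength ρ (n + 1) / (⌈sideLength ρ (n + 1) / l⌉₊ : ℝ)))}, ‖Ψ.ψ (Matrix.vecCons x Y')‖ ^ 2)))

/-- The crux functional `I(cell_l(x₁) ; Y)` of `Ψ`, verbatim the crux's left-hand side. -/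
noncomputable def cellMI (ρ l : ℝ) (n : ℕ) (Ψ : TrialState (n + 1) (sideLength ρ (n + 1))) : ℝ≥0∞ :=
  ∫⁻ Y : Config n, ENNReal.ofReal (∑ k : Fin 3 → Fin ⌈sideLength ρ (n + 1) / l⌉₊, (∫ z, ‖Ψ.ψ (Matrix.vecCons z Y)‖ ^ 2) * (∫ Y' : Config n, ∫ x in {y : EuclideanSpace ℝ (Fin 3) | ∀ j, y j ∈ Set.Ico (((k j : ℕ) : ℝ) * (sideLength ρ (n + 1) / (⌈sideLength ρ (n + 1) / l⌉₊ : ℝ))) ((((k j : ℕ) : ℝ) + 1) * (sideLength ρ (n + 1) / (⌈sideLength ρ (n + 1) / l⌉₊ : ℝ)))}, ‖Ψ.ψ (Matrix.vecCons x Y')‖ ^ 2) * InformationTheory.klFun ((∫ x in {y : EuclideanSpace ℝ (Fin 3) | ∀ j, y j ∈ Set.Ico (((k j : ℕ) : ℝ) * (sideLength ρ (n + 1) / (⌈sideLength ρ (n + 1) / l⌉₊ : ℝ))) ((((k j : ℕ) : ℝ) + 1) * (sideLength ρ (n + 1) / (⌈sideLength ρ (n + 1) / l⌉₊ : ℝ)))},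 ‖Ψ.ψ (Matrix.vecCons x Y)‖ ^ 2) / ((∫ z, ‖Ψ.ψ (Matrix.vecCons z Y)‖ ^ 2) * (∫ Y' : Config n, ∫ x in {y : EuclideanSpace ℝ (Fin 3) | ∀ j, y j ∈ Set.Ico (((k j : ℕ) : ℝ) * (sideLength ρ (n + 1) / (⌈sideLength ρ (n + 1) / l⌉₊ : ℝ))) ((((k j : ℕ) : ℝ) + 1) * (sideLength ρ (n + 1) / (⌈sideLength ρ (n + 1) / l⌉₊ : ℝ)))}, ‖Ψ.ψ (Matrix.vecCons x Y')‖ ^ 2))))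

/-- Sanity: the crux is literally `… → cellMI ρ l n Ψ ≤ ofReal C` (definitional unfolding). -/
theorem crux_iff :
    CellInformationBound ↔
    (∀ v : ℝ → ENNReal, IsRepulsiveFiniteRange v → ∃ ρ₀ : ℝ, 0 < ρ₀ ∧ ∀ ρ : ℝ, 0 < ρ → ρ < ρ₀ → ∃ l : ℝ, 0 < l ∧ ∃ C : ℝ, ∀ᶠ n : ℕ in Filter.atTop, ∃ δ : ENNReal, 0 < δ ∧ ∀ Ψ : TrialState (n + 1) (sideLength ρ (n + 1)), energy v Ψ ≤ groundStateEnergy v (n + 1) (sideLength ρ (n + 1)) + δ → (∀ X, Ψ.ψ X = (‖Ψ.ψ X‖ : ℂ)) → cellMI ρ l n Ψ ≤ ENNReal.ofReal C) :=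
  Iff.rfl

/-! ## Decomposition D1 — the `∃`-form core and the information transfer -/

/-- **D1, piece 1 (the core; OPEN, BEC-hard modulo 9072).**  `∀ δ ∃ Ψ`: for every slack some
non-negative `δ`-near-minimiser has bounded coarse mutual information — "the ground state is not
number-rigid at scale `l`", typed without a ground-state object. Weaker than the crux (`∃ δ ∀ Ψ`). -/
def GroundStateNonRigidity : Prop :=
  ∀ v : ℝ → ENNReal, IsRepulsiveFiniteRange v → ∃ ρ₀ : ℝ, 0 < ρ₀ ∧ ∀ ρ : ℝ, 0 < ρ → ρ < ρ₀ →
    ∃ l : ℝ, 0 < l ∧ ∃ C : ℝ, ∀ᶠ n : ℕ in Filter.atTop, ∀ δ : ENNReal, 0 < δ →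
      ∃ Ψ : TrialState (n + 1) (sideLength ρ (n + 1)),
        energy v Ψ ≤ groundStateEnergy v (n + 1) (sideLength ρ (n + 1)) + δ ∧
        (∀ X, Ψ.ψ X = (‖Ψ.ψ X‖ : ℂ)) ∧ cellMI ρ l n Ψ ≤ ENNReal.ofReal C

/-- **D1, piece 2 (PROVABLE NOW, size L).**  Phase rigidity below the finite-`N` gap (item 9072)
turns the `∃`-form into the crux's `∀`-form: at fixed `n` the alphabet `Fin 3 → Fin M` is finite,
`I(K;Y) = H(K) − H(K|Y)` is uniformly continuous in the total-variation distance of the joint law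
(`|ΔI| ≤ 2(ε log M³ + (1+ε) h(ε/(1+ε)))`, Fannes + Alicki–Fannes–Winter), and for non-negative
`Ψ, Φ`: `TV(|Ψ|²,|Φ|²) ≤ 2‖Ψ − Φ‖₂ ≤ 2‖Ψ − cΦ‖₂`; choose `ε` with `2(ε log M³ + …) ≤ 1`,
`η := ε²/4`, `δ :=` the rigidity `δ(n, η)`, and the witness of piece 1 at that `δ`.
[cite: Winter2016 (doi:10.1007/s00220-016-2609-8) Lemma 2; AlhejjiSmith2019 arXiv:1909.00787 Thm 1;
CoverThomas2005 Thm 17.3.3] -/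
def InformationTransfer : Prop :=
  GroundStateRigidity → GroundStateNonRigidity → CellInformationBound

/-- D1 glue (modus ponens): the crux from the two pieces and the route's own crux 9072. -/
theorem cellInformationBound_of_core (h₁ : GroundStateNonRigidity) (h₂ : InformationTransfer)
    (hR : GroundStateRigidity) : CellInformationBound :=
  h₂ hR h₁

/-- D1 converse direction of sizing: the crux implies the core outright, given only that
non-negative near-minimisers exist eventually (items 13442 + 13445, both LANDED; packaged here as
a hypothesis in the exact shape needed). So the core is sandwiched:
`core + 9072 + transfer ⇒ crux ⇒ core`. -/
theorem core_of_crux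
    (hex : ∀ v : ℝ → ENNReal, IsRepulsiveFiniteRange v → ∃ ρ₀ : ℝ, 0 < ρ₀ ∧ ∀ ρ : ℝ, 0 < ρ → ρ < ρ₀ →
      ∀ᶠ n : ℕ in Filter.atTop, ∀ δ : ENNReal, 0 < δ →
        ∃ Ψ : TrialState (n + 1) (sideLength ρ (n + 1)),
          energy v Ψ ≤ groundStateEnergy v (n + 1) (sideLength ρ (n + 1)) + δ ∧ (∀ X, Ψ.ψ X = (‖Ψ.ψ X‖ : ℂ)))
    (h : CellInformationBound) : GroundStateNonRigidity := by
  intro v hv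
  obtain ⟨ρ₁, hρ₁, H₁⟩ := h v hv
  obtain ⟨ρ₂, hρ₂, H₂⟩ := hex v hv
  refine ⟨min ρ₁ ρ₂, lt_min hρ₁ hρ₂, fun ρ hρ hρlt => ?_⟩
  obtain ⟨l, hl, C, hev⟩ := H₁ ρ hρ (lt_of_lt_of_le hρlt (min_le_left _ _))
  refine ⟨l, hl, C, ?_⟩
  filter_upwards [hev, H₂ ρ hρ (lt_of_lt_of_le hρlt (min_le_right _ _))] with n hn hn₂ δ hδ
  obtain ⟨δ₁, hδ₁, hΨ⟩ := hn
  obtain ⟨Ψ, hE, hpos⟩ := hn₂ (min δ δ₁) (lt_min hδ hδ₁)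
  have h1 : groundStateEnergy v (n + 1) (sideLength ρ (n + 1)) + min δ δ₁ ≤
      groundStateEnergy v (n + 1) (sideLength ρ (n + 1)) + δ := by
    gcongr; exact min_le_left _ _
  have h2 : groundStateEnergy v (n + 1) (sideLength ρ (n + 1)) + min δ δ₁ ≤
      groundStateEnergy v (n + 1) (sideLength ρ (n + 1)) + δ₁ := by
    gcongr; exact min_le_right _ _
  exact ⟨Ψ, le_trans hE h1, hpos, hΨ Ψ (le_trans hE h2) hpos⟩

/-! ## Strengthen S⁺₂ — the essential-supremum (pointwise-in-`Y`) form -/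

/-- **S⁺₂ (STRONGER than the crux; no leverage).**  For `m(Y)dY`-a.e. bath configuration the
conditional law of the tagged boson's cell is within `C` nats of its mean law:
`m(Y)·KL(Q(·|Y)‖P) ≤ C·m(Y)` for a.e. `Y` (so `KL ≤ C` wherever `m > 0`). Implies the crux by
`lintegral_mono_ae` and `∫ m = 1`. Removes the average over the bath — but `x ↦ Ψ₀(x,Y)` at frozen `Y`
obeys no equation in `x`, and adversarial (caging) `Y` must now be handled individually. -/
def EssSupForm : Prop :=
  ∀ v : ℝ → ENNReal, IsRepulsiveFiniteRange v → ∃ ρ₀ : ℝ, 0 < ρ₀ ∧ ∀ ρ : ℝ, 0 < ρ → ρ < ρ₀ → ∃ l : ℝ, 0 < l ∧ ∃ C : ℝ, ∀ᶠ n : ℕ in Filter.atTop, ∃ δ : ENNReal, 0 < δ ∧ ∀ Ψ : TrialState (n + 1) (sideLength ρ (n + 1)), energy v Ψ ≤ groundStateEnergy v (n + 1) (sideLength ρ (n + 1)) + δ → (∀ X, Ψ.ψ X = (‖Ψ.ψ X‖ : ℂ)) → ∀ᵐ Y : Config n, cellKL ρ l n Ψ Y ≤ C * mass Ψ Y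

/-! ## Decomposition D4 — in-probability form × concentration (and the RIGHT-SIZING remark) -/

/-- **D4, piece 1 = the in-probability ("weak") form.**  With `m`-probability at least `c₀`,
the conditional KL is at most `C`: `ofReal c₀ ≤ ∫⁻_{Y : cellKL ≤ C·m} ofReal(m(Y))`.  WEAKER than the
crux (Markov).  REMARK (route level, for the tenure planner): this weak form is all that `closes`
needs — `n₀/N = E_m e^{−D_½(p(·|Y)‖u)} ≥ e^{−t}·P_m(D_½ ≤ t)` replaces Jensen in `EntropicZeroMode`,
and the within-cell / profile terms are already controlled in expectation (items 13440/13441/13443,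
landed) hence in probability; and in its Rényi-½ version it is IMPLIED by BEC for positive ground
states (Reatto identity + data processing), i.e. BEC-equivalent modulo the frame, whereas the
expectation-form crux may be strictly stronger than BEC. -/
def WeakCellInformation : Prop :=
  ∀ v : ℝ → ENNReal, IsRepulsiveFiniteRange v → ∃ ρ₀ : ℝ, 0 < ρ₀ ∧ ∀ ρ : ℝ, 0 < ρ → ρ < ρ₀ →
    ∃ l : ℝ, 0 < l ∧ ∃ c₀ : ℝ, 0 < c₀ ∧ ∃ C : ℝ, ∀ᶠ n : ℕ in Filter.atTop, ∃ δ : ENNReal, 0 < δ ∧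
      ∀ Ψ : TrialState (n + 1) (sideLength ρ (n + 1)),
        energy v Ψ ≤ groundStateEnergy v (n + 1) (sideLength ρ (n + 1)) + δ →
        (∀ X, Ψ.ψ X = (‖Ψ.ψ X‖ : ℂ)) →
        ENNReal.ofReal c₀ ≤ ∫⁻ Y in {Y : Config n | cellKL ρ l n Ψ Y ≤ C * mass Ψ Y}, ENNReal.ofReal (mass Ψ Y)

/-- **D4, piece 2 = concentration of `Y ↦ KL(Q(·|Y)‖P)` under `m(Y)dY` (variance form).**
`Var_m(KL) ≤ V` uniformly in `N`.  With piece 1, Chebyshev gives the crux with `C + √(V/c₀)`.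
Heuristically `|∇_Y KL|² ≍ ρ²a²R₀²/N`, so a Poincaré constant `o(N)` for `m(Y)dY` — a spectral gap of
the Dirichlet `H_N` above `E₀` of size `≫ 1/N` on the one-tagged-particle sector — would prove it;
no `N`-uniform lower bound on that gap is in print (the free value `3π²/L² ≍ N^{-2/3}` would suffice
by a wide margin but does not transfer to `v ≠ 0` by any known argument). -/
def KLVarianceBound : Prop :=
  ∀ v : ℝ → ENNReal, IsRepulsiveFiniteRange v → ∃ ρ₀ : ℝ, 0 < ρ₀ ∧ ∀ ρ : ℝ, 0 < ρ → ρ < ρ₀ → ∃ l : ℝ, 0 < l ∧ ∃ C : ℝ, ∀ᶠ n : ℕ in Filter.atTop, ∃ δ : ENNReal, 0 < δ ∧ ∀ Ψ : TrialState (n + 1) (sideLength ρ (n + 1)), energy v Ψ ≤ groundStateEnergy v (n + 1) (sideLength ρ (n + 1)) + δ → (∀ X, Ψ.ψ X = (‖Ψ.ψ X‖ : ℂ)) → ∫⁻ Y, ENNReal.ofReal (mass Ψ Y * (cellKL ρ l n Ψ Y / mass Ψ Y -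
      ∫ Y', cellKL ρ l n Ψ Y') ^ 2) ≤ ENNReal.ofReal C

/-! ## Negation — the typed obstruction (what a counterexample would have to beat) -/

/-- **N1.**  Without the near-minimiser hypothesis the trivial ceiling `log M³` is attained
(symmetric "cat" state: all `N` bosons in one common cell, uniformly mixed over cells ⇒
`Q(·|Y) = δ_{k(Y)}`, `P` uniform, `I = log M³ → ∞`): the energy window is load-bearing, and any
counterexample to the crux must be a GENUINE near-ground state that is number-rigid at a fixed
scale — a low-density quantum solid / glass for some admissible `v`, which no admissible `v` is known
(or believed) to produce for `ρ < ρ₀(v)`.  Stated, not proved (construction = `C¹` bumps; it is the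
`_false_without_nearMin` target a disprover would land). -/
def CeilingAttainedWithoutNearMin : Prop :=
  ∀ ρ : ℝ, 0 < ρ → ∀ l : ℝ, 0 < l → ∀ C : ℝ, ∀ᶠ n : ℕ in Filter.atTop,
    ∃ Ψ : TrialState (n + 1) (sideLength ρ (n + 1)),
      (∀ X, Ψ.ψ X = (‖Ψ.ψ X‖ : ℂ)) ∧ ENNReal.ofReal C < cellMI ρ l n Ψ

/-- **N2 (the refuter's target, typed): `¬ crux` in useful form.**  Some admissible `v` whose
non-negative near-minimisers carry UNBOUNDED coarse information at every fixed scale, at densities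
accumulating at `0`.  Recorded so that a disprover seat has the exact shape; every attempted witness
(hollow-shell cages, hard spheres, Dirichlet walls, canonical `S(0)=0` constraint, symmetric
admixtures) fails for the reasons listed in STRATEGY-CENSUS.md §Negation. -/
def RigidAdmissiblePotential : Prop :=
  ∃ v : ℝ → ENNReal, IsRepulsiveFiniteRange v ∧ ∀ ρ₀ : ℝ, 0 < ρ₀ → ∃ ρ : ℝ, 0 < ρ ∧ ρ < ρ₀ ∧
    ∀ l : ℝ, 0 < l → ∀ C : ℝ, ∃ᶠ n : ℕ in Filter.atTop, ∀ δ : ENNReal, 0 < δ →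
      ∃ Ψ : TrialState (n + 1) (sideLength ρ (n + 1)),
        energy v Ψ ≤ groundStateEnergy v (n + 1) (sideLength ρ (n + 1)) + δ ∧
        (∀ X, Ψ.ψ X = (‖Ψ.ψ X‖ : ℂ)) ∧ ENNReal.ofReal C < cellMI ρ l n Ψ

/-- N2 is exactly the negation of the crux (quantifier push; sorry-free). -/
theorem rigidAdmissiblePotential_iff_not_crux : RigidAdmissiblePotential ↔ ¬ CellInformationBound := by
  constructor
  · rintro ⟨v, hv, H⟩ h
    obtain ⟨ρ₀, hρ₀, H'⟩ := h v hv
    obtain ⟨ρ, hρ, hρlt, Hρ⟩ := H ρ₀ hρ₀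
    obtain ⟨l, hl, C, hev⟩ := H' ρ hρ hρlt
    have hfr := Hρ l hl C
    obtain ⟨n, hall, δ, hδ, hΨ⟩ := (hfr.and_eventually hev).exists
    obtain ⟨Ψ, hE, hpos, hlt⟩ := hall δ hδ
    exact absurd (hΨ Ψ hE hpos) (not_le.mpr hlt)
  · intro h
    by_contra hne
    apply h
    intro v hv
    by_contra hcon
    apply hne
    refine ⟨v, hv, fun ρ₀ hρ₀ => ?_⟩
    by_contra hρ
    apply hcon
    refine ⟨ρ₀, hρ₀, fun ρ hρpos hρlt => ?_⟩
    by_contra hlC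
    apply hρ
    refine ⟨ρ, hρpos, hρlt, fun l hl C => ?_⟩
    rw [Filter.Frequently]
    intro hev
    apply hlC
    refine ⟨l, hl, C, ?_⟩
    filter_upwards [hev] with n hn
    by_contra hnδ
    apply hn
    intro δ hδ
    by_contra hΨ
    apply hnδ
    refine ⟨δ, hδ, fun Ψ hE hpos => ?_⟩
    by_contra hlt
    exact hΨ ⟨Ψ, hE, hpos, not_le.mp hlt⟩

end Summit.AtomisticToContinuum.BoseEinsteinCondensation.Cruxes.CellInformationBound.Strategist
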